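import Summits.Ventures.PercRepro.C025ProfileColoop
import Summits.Ventures.PercRepro.C025ProfileStep

/-!
# PercRepro — C-032 PROFILE (Π): `(Π_{1,u})` FOR EVERY SIMPLE MATROID (night-3, gen 6)

**`profileIneq_one_of_simple`**: for every finite matroid in which every subset with at most two elements is
independent and every level `u ≥ 1`, `Profile.ProfileIneq M 1 u`, i.e.
`#{S : ρ(S) = u} ≥ Σ_{x ∈ E, ρ(E∖x) ≥ u} C(ρ(E∖x)+1, u)/(ρ(E∖x)+1)` — the `q = 1` row of C-032 on simple matroids
(NIGHT3-G6-PROFILE.md §7(e)/§8; with Theorem D's coefficient argument, §7(d), it is the row for every matroid).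

Proof: induction on the number of coloops `ccol M` (`T1_le_card_levelSet_of_simple`). The coloop-free case is
Theorem B′ (`profileIneq_one_of_simple_coloopFree`, C025ProfileCases); the all-coloop (free) case is direct
(`T1_le_card_levelSet_of_ncol_zero`, `choose_le_card_levelSet`); otherwise a coloop `e` is deleted — the level splits
(`card_levelSet_of_isColoop`), the right side is the closed form `T1` (`sum_price_eq_T1`) and the arithmetic step is
`Profile.T1_step` (C025ProfileStep), whose hypotheses `m ≥ 2`, `m + c ≥ R + 1`, `R ≥ 2` come from the structural facts
of C025ProfileColoop; the level `u = 1` is `|E| ≥ m + c·[2 ≤ R]` directly.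
-/

open scoped Matroid

namespace PercRepro

open Set Finset ThmH

section ProfileOneAll

variable {α : Type} {M : Matroid α} [DecidableEq α] [M.Finite]

/-! ### The induction on the coloops -/

omit [DecidableEq α] in
/-- `levelSet M 1 = Rq M 1` (the same filter). -/
theorem levelSet_one_eq_Rq : Shadow.levelSet M 1 = Profile.Rq M 1 := rfl

omit [DecidableEq α] in
open scoped Classical in
/-- The free case: every point a coloop. Then `#levelSet M u ≥ C(ρ(E), u)` and `T1 0 R R u ≤ C(R,u)`. -/
theorem T1_le_card_levelSet_of_ncol_zero (h0 : ncol M = 0)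
    (u : ℕ) (hu : 1 ≤ u) : Profile.T1 (ncol M) M.eRank.toNat (ccol M) u ≤ ((Shadow.levelSet M u).card : ℚ) := by
  -- every point is a coloop, the coloops are independent, so E is independent and |E| = ρ(E) = ccol M
  have hall : ∀ x ∈ M.E, M.IsColoop x := by
    intro x hx
    by_contra hcon
    have : x ∈ (gr M).filter (fun y => ¬ M.IsColoop y) := by
      rw [Finset.mem_filter]; exact ⟨by rw [← Finset.mem_coe, coe_gr]; exact hx, hcon⟩
    unfold ncol at h0
    rw [Finset.card_eq_zero] at h0
    rw [h0] at this
    exact Finset.notMem_empty _ this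
  have hEcol : M.E ⊆ M.coloops := fun x hx => hall x hx
  have hind : M.Indep M.E := M.coloops_indep.subset hEcol
  have hcard : (gr M).card = M.eRank.toNat := by
    have h1 : M.eRank = M.E.encard := by rw [M.eRank_def, hind.eRk_eq_encard]
    rw [h1, ← coe_gr, Set.encard_coe_eq_coe_finsetCard, ENat.toNat_coe]
  have hc : ccol M = (gr M).card := by
    unfold ccol
    rw [Finset.filter_true_of_mem]
    intro x hx
    exact hall x (by rw [← coe_gr]; exact_mod_cast hx)
  have hlevel : Nat.choose (gr M).card u ≤ (Shadow.levelSet M u).card :=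
    choose_le_card_levelSet (fun T hT _ => hind.subset hT)
  rw [h0, hc, hcard]
  unfold Profile.T1 Profile.T
  set R := M.eRank.toNat with hR
  rw [hcard] at hlevel
  split_ifs with h1 h2
  · -- u ≤ R, u + 1 ≤ R
    have hRpos : (0 : ℚ) < R := by exact_mod_cast (show 0 < R by omega)
    rw [Nat.cast_zero, zero_mul, zero_div, zero_add, mul_div_cancel₀ _ (ne_of_gt hRpos)]
    exact_mod_cast hlevel
  · rw [Nat.cast_zero, zero_mul, zero_div, zero_add, mul_zero]
    exact Nat.cast_nonneg _
  · exact Nat.cast_nonneg _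

open scoped Classical in
/-- **`(Π_{1,u})` for every simple matroid**, by induction on the number of coloops (the single-coloop step `T1_step`). -/
theorem T1_le_card_levelSet_of_simple (k : ℕ) : ∀ (M : Matroid α) [M.Finite],
    (∀ T ⊆ M.E, T.encard ≤ 2 → M.Indep T) → ccol M = k → ∀ u, 1 ≤ u →
      Profile.T1 (ncol M) M.eRank.toNat (ccol M) u ≤ ((Shadow.levelSet M u).card : ℚ) := by
  induction k with
  | zero =>
    intro M _ hsimple hk u hu
    have hcolfree : ∀ e, ¬ M.IsColoop e := by
      intro e he
      have : e ∈ (gr M).filter (fun y => M.IsColoop y) := by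
        rw [Finset.mem_filter]; exact ⟨by rw [← Finset.mem_coe, coe_gr]; exact he.mem_ground, he⟩
      unfold ccol at hk
      rw [Finset.card_eq_zero] at hk
      rw [hk] at this
      exact Finset.notMem_empty _ this
    have h := profileIneq_one_of_simple_coloopFree hsimple hcolfree u hu
    unfold Profile.ProfileIneq at h
    rw [sum_price_eq_T1 hsimple u] at h
    rw [hk] at h ⊢
    exact h
  | succ k ih =>
    intro M _ hsimple hk u hu
    by_cases h0 : ncol M = 0
    · exact T1_le_card_levelSet_of_ncol_zero h0 u hu
    -- a non-coloop x exists; hence m ≥ 2 and |E| ≥ R + 1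
    obtain ⟨x, hx⟩ : ∃ x ∈ gr M, ¬ M.IsColoop x := by
      by_contra hcon
      push Not at hcon
      apply h0
      unfold ncol
      rw [Finset.card_eq_zero, Finset.filter_eq_empty_iff]
      intro y hy hny
      exact hny (hcon y hy)
    have hxE : x ∈ M.E := by rw [← coe_gr]; exact_mod_cast hx.1
    obtain ⟨y, hyE, hyx, hy⟩ := exists_other_not_isColoop hsimple hxE hx.2
    have hm2 : 2 ≤ ncol M := by
      unfold ncol
      have hxm : x ∈ (gr M).filter (fun z => ¬ M.IsColoop z) := by
        rw [Finset.mem_filter]; exact ⟨hx.1, hx.2⟩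
      have hym : y ∈ (gr M).filter (fun z => ¬ M.IsColoop z) := by
        rw [Finset.mem_filter]; exact ⟨by rw [← Finset.mem_coe, coe_gr]; exact hyE, hy⟩
      have : ({x, y} : Finset α) ⊆ (gr M).filter (fun z => ¬ M.IsColoop z) := by
        intro z hz
        rw [Finset.mem_insert, Finset.mem_singleton] at hz
        rcases hz with rfl | rfl
        · exact hxm
        · exact hym
      have h2 := Finset.card_le_card this
      rw [Finset.card_pair (Ne.symm hyx)] at h2
      exact h2
    have hRle : M.eRank.toNat + 1 ≤ ncol M + ccol M := by
      rw [← card_gr_eq_ncol_add_ccol]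
      exact eRank_toNat_add_one_le_card_gr_of_not_isColoop hxE hx.2
    -- the coloop e and the deletion M' := M ＼ {e}
    obtain ⟨e, he⟩ := exists_isColoop_of_ccol_pos (M := M) (by omega)
    have hsimple' := simple_delete hsimple e
    have hc' : ccol (M ＼ ({e} : Set α)) = k := by have := ccol_delete_of_isColoop (M := M) he; omega
    have hn' : ncol (M ＼ ({e} : Set α)) = ncol M := ncol_delete_of_isColoop he
    have hR' : M.eRank.toNat = (M ＼ ({e} : Set α)).eRank.toNat + 1 := eRank_toNat_delete_of_isColoop he
    -- rank of M is at least 2 (a simple matroid of rank 1 has ≤ 1 point, but |E| ≥ 2)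
    have hR2 : 2 ≤ M.eRank.toNat := by
      by_contra hlt
      push Not at hlt
      have hEcard : 2 ≤ (gr M).card := by
        have := Finset.card_le_card (show ({x, y} : Finset α) ⊆ gr M by
          intro z hz
          rw [Finset.mem_insert, Finset.mem_singleton] at hz
          rcases hz with rfl | rfl
          · exact hx.1
          · rw [← Finset.mem_coe, coe_gr]; exact hyE)
        rw [Finset.card_pair (Ne.symm hyx)] at this
        exact this
      rcases (by omega : M.eRank.toNat = 0 ∨ M.eRank.toNat = 1) with h01 | h01
      · -- rank 0: no points at all in a simple (loopless) matroid — contradiction with x ∈ E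
        have hind : M.Indep {x} := hsimple _ (Set.singleton_subset_iff.2 hxE) (by simp)
        have h1 : M.eRk ({x} : Set α) ≤ M.eRank := M.eRk_le_eRank _
        rw [hind.eRk_eq_encard, Set.encard_singleton] at h1
        have hRtop : M.eRank ≠ ⊤ := M.eRank_ne_top_iff.2 inferInstance
        rw [← ENat.coe_toNat hRtop, h01] at h1
        exact absurd h1 (by decide)
      · have := card_gr_le_one_of_eRank_one hsimple h01
        omega
    -- the induction hypothesis at the levels u and u − 1 on M'
    rcases (by omega : u = 1 ∨ 2 ≤ u) with hu1 | hu2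
    · -- level 1: #levelSet M 1 = |E| and T1 ≤ m + c
      subst hu1
      rw [levelSet_one_eq_Rq, Rq_one_eq_image_singleton hsimple,
        Finset.card_image_of_injective _ Finset.singleton_injective, card_gr_eq_ncol_add_ccol]
      unfold Profile.T1 Profile.T
      rw [if_pos (by omega)]
      rw [Nat.choose_one_right, Nat.choose_one_right]
      push_cast
      have hRq : (0 : ℚ) < M.eRank.toNat := by exact_mod_cast (show 0 < M.eRank.toNat by omega)
      rw [mul_div_assoc, div_self (by positivity), mul_one, if_pos (by omega : 1 + 1 ≤ M.eRank.toNat),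
        div_self (ne_of_gt hRq), mul_one]
    · obtain ⟨v, rfl⟩ : ∃ v, u = v + 1 := ⟨u - 1, by omega⟩
      have ih1 := ih (M ＼ ({e} : Set α)) hsimple' hc' (v + 1) (by omega)
      have ih2 := ih (M ＼ ({e} : Set α)) hsimple' hc' v (by omega)
      rw [hn', hc'] at ih1 ih2
      have hlev := card_levelSet_of_isColoop he v
      have hstep := Profile.T1_step (ncol M) (M ＼ ({e} : Set α)).eRank.toNat k v (by omega) (by omega) hm2
      rw [hk, hR']
      calc Profile.T1 (ncol M) ((M ＼ ({e} : Set α)).eRank.toNat + 1) (k + 1) (v + 1)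
          ≤ Profile.T1 (ncol M) (M ＼ ({e} : Set α)).eRank.toNat k (v + 1) +
              Profile.T1 (ncol M) (M ＼ ({e} : Set α)).eRank.toNat k v := hstep
        _ ≤ ((Shadow.levelSet (M ＼ ({e} : Set α)) (v + 1)).card : ℚ) +
              ((Shadow.levelSet (M ＼ ({e} : Set α)) v).card : ℚ) := add_le_add ih1 ih2
        _ = ((Shadow.levelSet M (v + 1)).card : ℚ) := by rw [hlev]; push_cast; ring

/-- **`(Π_{1,u})` FOR EVERY SIMPLE MATROID** (every subset with at most two elements independent), every `u ≥ 1`: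
the coloop-free case is Theorem B′, the coloops are added one at a time (`card_levelSet_of_isColoop` + `T1_step`). -/
theorem profileIneq_one_of_simple (hsimple : ∀ T ⊆ M.E, T.encard ≤ 2 → M.Indep T) (u : ℕ) (hu : 1 ≤ u) :
    Profile.ProfileIneq M 1 u := by
  classical
  unfold Profile.ProfileIneq
  rw [sum_price_eq_T1 hsimple u]
  exact T1_le_card_levelSet_of_simple (ccol M) M hsimple rfl u hu

end ProfileOneAll

end PercRepro
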